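import Literature.Topology.FourManifolds.SimplifiedBrokenLefschetzMorseCharts
import Literature.Topology.FourManifolds.SimplifiedBrokenLefschetzRoundImage
import Mathlib.Analysis.InnerProductSpace.Calculus
import Mathlib.Analysis.Calculus.ContDiff.Deriv
import HarnessLib

/-!
# The tilted height of a broken Lefschetz fibration with equatorial round image

Topic `Literature/Topology/FourManifolds`; the Morse-theoretic half of the Euler count
`card_eq_four_mul_of_sblf_of_homotopyEquiv_sphere_four` (Baykur 2012, Lemma 7) of
`SimplifiedBrokenLefschetzFibration.lean`.  For an SBLF `f : X → S²` whose round image is the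
equator `{v₂ = 0}` (`SimplifiedBrokenLefschetzRoundImage.lean`) and the linear height
`Λ_ε = v₂ + ε v₀` (`ε ≠ 0`), the critical points of `Λ_ε ∘ f` are: the two fibres over the poles
`±(ε, 0, 1)/√(1 + ε²)` (degenerate, values `±√(1 + ε²)`), the Lefschetz points (nondegenerate
of index `2` when their values are not poles), and the two round points over `(±1, 0, 0)`
(nondegenerate, of an index whose parity flips under `ε ↦ -ε`).  Everything here is **proved**;
no definitions, no named facts.

## References

* R. İ. Baykur, *Broken Lefschetz fibrations and smooth structures on 4-manifolds*,
  Geom. Topol. Monogr. 18 (2012), Lemma 7. [Baykur2012]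
* J. Milnor, *Morse theory* (1963), §2. [Milnor1963]
* K. Hayano, *On genus-1 simplified broken Lefschetz fibrations*, Algebr. Geom. Topol. 11
  (2011), Def. 2.1. [Hayano2011]
-/

noncomputable section

open scoped Manifold ContDiff Topology RealInnerProductSpace EuclideanSpace
open Set Function Filter
open Literature.AlgebraicTopology.SingularHomology

namespace Literature.Topology.FourManifolds

universe u

/-! ### Calculus along lines -/

section LineCalculus

variable {F : Type*} [NormedAddCommGroup F] [NormedSpace ℝ F]
  {G : Type*} [NormedAddCommGroup G] [NormedSpace ℝ G]

/-- The derivative of `s ↦ Φ (s • d)` is `DΦ (s • d) d`. [folklore] -/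
theorem hasDerivAt_comp_smul_const {Φ : F → G} {d : F} {t : ℝ}
    (hΦ : DifferentiableAt ℝ Φ (t • d)) :
    HasDerivAt (fun s : ℝ => Φ (s • d)) (fderiv ℝ Φ (t • d) d) t := by
  have h1 : HasDerivAt (fun s : ℝ => s • d) ((1 : ℝ) • d) t := (hasDerivAt_id t).smul_const d
  rw [one_smul] at h1
  exact hΦ.hasFDerivAt.comp_hasDerivAt t h1

/-- `deriv` form of `hasDerivAt_comp_smul_const`. [folklore] -/
theorem deriv_comp_smul_const {Φ : F → G} {d : F} {t : ℝ} (hΦ : DifferentiableAt ℝ Φ (t • d)) :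
    deriv (fun s : ℝ => Φ (s • d)) t = fderiv ℝ Φ (t • d) d :=
  (hasDerivAt_comp_smul_const hΦ).deriv

/-- **The second derivative along a line is the second Fréchet derivative on the diagonal**:
for `φ` of class `C²` at `0`, `(d/ds)² φ(s d) |₀ = D²φ(0)(d, d)`. [folklore] -/
theorem deriv_deriv_comp_smul_const {φ : F → ℝ} {d : F} (hφ : ContDiffAt ℝ 2 φ 0) :
    deriv (deriv (fun s : ℝ => φ (s • d))) 0 = fderiv ℝ (fderiv ℝ φ) 0 d d := by
  have hev : ∀ᶠ u in 𝓝 (0 : F), ContDiffAt ℝ 2 φ u := hφ.eventually (by simp)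
  have hline : Tendsto (fun s : ℝ => s • d) (𝓝 0) (𝓝 0) := by
    have hc : Continuous (fun s : ℝ => s • d) := continuous_id.smul continuous_const
    simpa using hc.tendsto 0
  have hev' : ∀ᶠ s in 𝓝 (0 : ℝ), DifferentiableAt ℝ φ (s • d) :=
    (hline.eventually hev).mono fun s hs => hs.differentiableAt (by simp)
  have h1 : deriv (fun s : ℝ => φ (s • d)) =ᶠ[𝓝 0] fun s => fderiv ℝ φ (s • d) d :=
    hev'.mono fun s hs => deriv_comp_smul_const hs
  rw [h1.deriv_eq]
  have h2 : DifferentiableAt ℝ (fderiv ℝ φ) ((0 : ℝ) • d) := by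
    rw [zero_smul]
    exact (hφ.fderiv_right (m := 1) (by norm_num)).differentiableAt (by simp)
  have h3 : HasDerivAt (fun s : ℝ => fderiv ℝ φ (s • d))
      (fderiv ℝ (fderiv ℝ φ) ((0 : ℝ) • d) d) 0 := hasDerivAt_comp_smul_const h2
  have h4 := h3.clm_apply (hasDerivAt_const (0 : ℝ) d)
  simp only [zero_smul, map_zero, add_zero] at h4
  exact h4.deriv

end LineCalculus

/-! ### Linear heights on the `2`-sphere -/

section SphereHeight

/-- A linear form restricted to the sphere is smooth. [folklore] -/
theorem contMDiff_apply_sphere (Λ : EuclideanSpace ℝ (Fin 3) →L[ℝ] ℝ) :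
    ContMDiff (𝓡 2) 𝓘(ℝ, ℝ) ∞
      (fun w : Metric.sphere (0 : EuclideanSpace ℝ (Fin 3)) 1 => Λ w) :=
  Λ.contDiff.comp_contMDiff contMDiff_coe_sphere

/-- A linear form `⟪n₀, ·⟫` is bounded by `‖n₀‖` on the unit sphere. [folklore] -/
theorem abs_apply_le_norm_of_mem_sphere (n₀ : EuclideanSpace ℝ (Fin 3))
    (Λ : EuclideanSpace ℝ (Fin 3) →L[ℝ] ℝ) (hΛ : ∀ x, Λ x = ⟪n₀, x⟫)
    (v : Metric.sphere (0 : EuclideanSpace ℝ (Fin 3)) 1) : |Λ v| ≤ ‖n₀‖ := by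
  rw [hΛ]
  have h := abs_real_inner_le_norm n₀ (v : EuclideanSpace ℝ (Fin 3))
  rwa [norm_eq_of_mem_sphere v, mul_one] at h

/-- **Critical points of a linear height on the sphere are the two poles**: if the differential
of `⟪n₀, ·⟫|_{S²}` vanishes at `v` then `n₀ ∈ ℝ v` (it is orthogonal to `T_v S² = v^⊥`), so
`⟪n₀, v⟫ = ±‖n₀‖`. [cite: Milnor1963, §2] -/
theorem apply_eq_norm_or_of_mfderiv_eq_zero (n₀ : EuclideanSpace ℝ (Fin 3))
    (Λ : EuclideanSpace ℝ (Fin 3) →L[ℝ] ℝ) (hΛ : ∀ x, Λ x = ⟪n₀, x⟫)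
    (v : Metric.sphere (0 : EuclideanSpace ℝ (Fin 3)) 1)
    (h0 : mfderiv (𝓡 2) 𝓘(ℝ, ℝ)
      (fun w : Metric.sphere (0 : EuclideanSpace ℝ (Fin 3)) 1 => Λ w) v = 0) :
    Λ v = ‖n₀‖ ∨ Λ v = -‖n₀‖ := by
  set D : EuclideanSpace ℝ (Fin 2) →L[ℝ] EuclideanSpace ℝ (Fin 3) :=
    mfderiv (𝓡 2) 𝓘(ℝ, EuclideanSpace ℝ (Fin 3))
      (Subtype.val : Metric.sphere (0 : EuclideanSpace ℝ (Fin 3)) 1 → EuclideanSpace ℝ (Fin 3)) v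
    with hD
  have hval : HasMFDerivAt (𝓡 2) 𝓘(ℝ, EuclideanSpace ℝ (Fin 3))
      (Subtype.val : Metric.sphere (0 : EuclideanSpace ℝ (Fin 3)) 1 → EuclideanSpace ℝ (Fin 3))
      v D :=
    ((contMDiff_coe_sphere (m := 1) v).mdifferentiableAt one_ne_zero).hasMFDerivAt
  have hcomp : HasMFDerivAt (𝓡 2) 𝓘(ℝ, ℝ)
      (fun w : Metric.sphere (0 : EuclideanSpace ℝ (Fin 3)) 1 => Λ w) v (Λ.comp D) :=
    Λ.hasFDerivAt.hasMFDerivAt.comp v hval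
  have hzero : Λ.comp D = 0 := hcomp.mfderiv ▸ h0
  -- `Λ` kills `T_v S² = (ℝ v)ᗮ`
  have hrange : D.range = (ℝ ∙ (v : EuclideanSpace ℝ (Fin 3)))ᗮ :=
    range_mfderiv_coe_sphere v
  have hkill : ∀ y ∈ (ℝ ∙ (v : EuclideanSpace ℝ (Fin 3)))ᗮ, ⟪y, n₀⟫ = 0 := by
    intro y hy
    rw [← hrange, LinearMap.mem_range] at hy
    obtain ⟨w, rfl⟩ := hy
    rw [real_inner_comm, ← hΛ]
    have := DFunLike.congr_fun hzero w
    simpa using this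
  have hmem : n₀ ∈ (ℝ ∙ (v : EuclideanSpace ℝ (Fin 3)))ᗮᗮ :=
    (Submodule.mem_orthogonal _ _).2 hkill
  rw [Submodule.orthogonal_orthogonal, Submodule.mem_span_singleton] at hmem
  obtain ⟨c, hc⟩ := hmem
  have hv1 : ‖(v : EuclideanSpace ℝ (Fin 3))‖ = 1 := norm_eq_of_mem_sphere v
  have hΛv : Λ v = c := by
    rw [hΛ, ← hc, real_inner_smul_left, real_inner_self_eq_norm_sq, hv1]; ring
  have hn : ‖n₀‖ = |c| := by rw [← hc, norm_smul, hv1, mul_one, Real.norm_eq_abs]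
  rw [hΛv, hn]
  rcases le_or_gt 0 c with h | h
  · left; rw [abs_of_nonneg h]
  · right; rw [abs_of_neg h]; ring

/-- Coordinates as inner products with the standard basis: `x i = ⟪eᵢ, x⟫`. [folklore] -/
theorem apply_eq_inner_single (x : EuclideanSpace ℝ (Fin 3)) (i : Fin 3) :
    x i = ⟪EuclideanSpace.single i (1 : ℝ), x⟫ := by
  rw [EuclideanSpace.inner_single_left]; simp

/-- The inner product of `ℝ³` in coordinates. [folklore] -/
private theorem inner_fin_three (x y : EuclideanSpace ℝ (Fin 3)) :
    ⟪x, y⟫ = x 0 * y 0 + x 1 * y 1 + x 2 * y 2 := by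
  simp [PiLp.inner_apply, Fin.sum_univ_three, mul_comm]

end SphereHeight

/-! ### Round points: criticality and index of the tilted height -/

section RoundPoint

variable {X : Type u} [TopologicalSpace X] [ChartedSpace (EuclideanSpace ℝ (Fin 4)) X]
  [IsManifold (𝓡 4) ∞ X]
  {o : SmoothOrientation (𝓡 4) X} {f : X → Metric.sphere (0 : EuclideanSpace ℝ (Fin 3)) 1}
  {L : Finset X} {h : ℕ}

set_option maxHeartbeats 800000 in
/-- **The tilted height at a round point.**  Let `f` be an SBLF whose round image is the equator
`{v₂ = 0}`, `q₀` a round point, and `Λ_ε = v₂ + ε v₀` (`ε ≠ 0`).  Then (Baykur 2012, proof of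
Lemma 7, made quantitative; Milnor 1963, §2 for the index computation in the fold chart of Hayano
2011, Def. 2.1 (4)):
* `(f q₀)₂ = 0`;
* `q₀` is a critical point of `Λ_ε ∘ f` iff `(f q₀)₁ = 0`, i.e. `f q₀ = (±1, 0, 0)` — the derivative
  of `Λ_ε` along the round image, the equator, vanishes exactly there;
* in that case `q₀` is nondegenerate, of index `[0 < ε (f q₀)₀] + σ` with `σ ∈ {1, 2}` NOT
  depending on `ε`: in the fold chart the Hessian is `diag(α, 2β, 2β, -2β)` with
  `α = -ε (f q₀)₀ ‖γ'‖²` (second derivative of `ε v₀` along the unit circle `γ`) and `β` the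
  derivative of `v₂` across the equator, which is independent of `ε`.
[cite: Baykur2012, Lemma 7] [cite: Milnor1963, §2] [cite: Hayano2011, Def. 2.1 (4)] -/
theorem round_point_height (hf : IsSimplifiedBrokenLefschetzFibration o f L h)
    (hC : f '' ({p : X | ¬ Surjective (mfderiv (𝓡 4) (𝓡 2) f p)} \ (↑L : Set X)) =
      sphereEquator 1)
    {q₀ : X} (hq₀ : ¬ Surjective (mfderiv (𝓡 4) (𝓡 2) f q₀)) (hq₀L : q₀ ∉ L) :
    ((f q₀ : Metric.sphere (0 : EuclideanSpace ℝ (Fin 3)) 1) : EuclideanSpace ℝ (Fin 3)) 2 = 0 ∧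
    (∀ (ε : ℝ) (Λ : EuclideanSpace ℝ (Fin 3) →L[ℝ] ℝ), ε ≠ 0 → (∀ x, Λ x = x 2 + ε * x 0) →
      (IsMCriticalPt (𝓡 4)
          ((fun w : Metric.sphere (0 : EuclideanSpace ℝ (Fin 3)) 1 => Λ w) ∘ f) q₀ ↔
        ((f q₀ : Metric.sphere (0 : EuclideanSpace ℝ (Fin 3)) 1) : EuclideanSpace ℝ (Fin 3)) 1
          = 0)) ∧
    ∃ σ : ℕ, (σ = 1 ∨ σ = 2) ∧
      ∀ (ε : ℝ) (Λ : EuclideanSpace ℝ (Fin 3) →L[ℝ] ℝ), ε ≠ 0 → (∀ x, Λ x = x 2 + ε * x 0) →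
        ((f q₀ : Metric.sphere (0 : EuclideanSpace ℝ (Fin 3)) 1) : EuclideanSpace ℝ (Fin 3)) 1
          = 0 →
        (mhessian (𝓡 4)
            ((fun w : Metric.sphere (0 : EuclideanSpace ℝ (Fin 3)) 1 => Λ w) ∘ f) q₀).Nondegenerate ∧
          morseIndex (𝓡 4)
              ((fun w : Metric.sphere (0 : EuclideanSpace ℝ (Fin 3)) 1 => Λ w) ∘ f) q₀ =
            (if 0 < ε * ((f q₀ : Metric.sphere (0 : EuclideanSpace ℝ (Fin 3)) 1) :
                EuclideanSpace ℝ (Fin 3)) 0 then 1 else 0) + σ := by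
  -- the fold chart at `q₀`
  obtain ⟨φ, ψ, hq₀φ, hφ0, hmaps, hφ, hφs, hψ, hψs, hmodel⟩ := hf.fold q₀ hq₀ hq₀L
  have hfd : ∀ q, MDifferentiableAt (𝓡 4) (𝓡 2) f q := fun q =>
    (hf.contMDiff q).mdifferentiableAt (by simp)
  set e₀ : EuclideanSpace ℝ (Fin 2) := EuclideanSpace.single 0 1 with he₀
  set e₁ : EuclideanSpace ℝ (Fin 2) := EuclideanSpace.single 1 1 with he₁
  set a₀ : EuclideanSpace ℝ (Fin 4) := EuclideanSpace.single 0 1 with ha₀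
  set E0 : EuclideanSpace ℝ (Fin 3) := EuclideanSpace.single 0 1 with hE0
  set E2 : EuclideanSpace ℝ (Fin 3) := EuclideanSpace.single 2 1 with hE2
  have haxis0 : (φ q₀) 1 = 0 ∧ (φ q₀) 2 = 0 ∧ (φ q₀) 3 = 0 := by simp [hφ0]
  have hψf0 : ψ (f q₀) = 0 := by
    rw [apply_eq_foldNormalForm_of_fold_chart hmodel hq₀φ, hφ0]
    ext i; fin_cases i <;> simp
  have h0t : (0 : EuclideanSpace ℝ (Fin 2)) ∈ ψ.target := hψf0 ▸ ψ.map_source (hmaps hq₀φ)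
  have hsymm0 : ψ.symm 0 = f q₀ := by rw [← hψf0, ψ.left_inv (hmaps hq₀φ)]
  -- the axis of the chart maps to the equator: `ψ⁻¹ (t, 0) = f (φ⁻¹ (t, 0, 0, 0)) ∈ {v₂ = 0}`
  have haxis : ∀ t : ℝ, t • a₀ ∈ φ.target →
      t • e₀ ∈ ψ.target ∧ ((ψ.symm (t • e₀) : Metric.sphere (0 : EuclideanSpace ℝ (Fin 3)) 1) :
        EuclideanSpace ℝ (Fin 3)) 2 = 0 := by
    intro t ht
    have hq : φ.symm (t • a₀) ∈ φ.source := φ.map_target ht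
    have hφq : φ (φ.symm (t • a₀)) = t • a₀ := φ.right_inv ht
    have hψq : ψ (f (φ.symm (t • a₀))) = t • e₀ := by
      rw [apply_eq_foldNormalForm_of_fold_chart hmodel hq, hφq]
      ext i; fin_cases i <;> simp [he₀, ha₀]
    have hfq : f (φ.symm (t • a₀)) ∈ ψ.source := hmaps hq
    have hcrit : ¬ Surjective (mfderiv (𝓡 4) (𝓡 2) f (φ.symm (t • a₀))) := by
      rw [surjective_mfderiv_iff_of_fold_chart hmaps (hφ.of_le (by simp)) (hφs.of_le (by simp))
        (hψ.of_le (by simp)) (hψs.of_le (by simp)) hmodel hq (hfd _), not_not, hφq]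
      simp [ha₀]
    have hqL : φ.symm (t • a₀) ∉ L := fun hqL =>
      mfderiv_ne_zero_of_fold_chart hmaps (hφ.of_le (by simp)) (hφs.of_le (by simp))
        (hψ.of_le (by simp)) (hψs.of_le (by simp)) hmodel hq (hfd _)
        ((hf.lefschetz _ hqL).mfderiv_eq_zero)
    have hmem : f (φ.symm (t • a₀)) ∈ sphereEquator 1 := by
      rw [← hC]; exact mem_image_of_mem f ⟨hcrit, fun h' => hqL (Finset.mem_coe.1 h')⟩
    refine ⟨hψq ▸ ψ.map_source hfq, ?_⟩
    rw [← hψq, ψ.left_inv hfq]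
    exact (mem_sphereEquator_iff _).1 hmem
  -- the chart inverse followed by the inclusion, a smooth map of the plane into `ℝ³`
  set c : EuclideanSpace ℝ (Fin 2) → EuclideanSpace ℝ (Fin 3) := fun u =>
    ((ψ.symm u : Metric.sphere (0 : EuclideanSpace ℝ (Fin 3)) 1) : EuclideanSpace ℝ (Fin 3))
    with hcdef
  have hcs : ∀ u ∈ ψ.target, ContDiffAt ℝ ∞ c u := fun u hu => by
    have h1 : ContMDiffAt (𝓡 2) (𝓡 2) ∞ ψ.symm u :=
      (hψs u hu).contMDiffAt (ψ.open_target.mem_nhds hu)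
    have h2 : ContMDiffAt (𝓡 2) 𝓘(ℝ, EuclideanSpace ℝ (Fin 3)) ∞ c u :=
      (contMDiff_coe_sphere _).comp u h1
    exact contMDiffAt_iff_contDiffAt.1 h2
  have hsphere : ∀ u, ⟪c u, c u⟫ = 1 := fun u => by
    rw [real_inner_self_eq_norm_sq, norm_eq_of_mem_sphere (ψ.symm u)]; norm_num
  have hc0 : c 0 = ((f q₀ : Metric.sphere (0 : EuclideanSpace ℝ (Fin 3)) 1) :
      EuclideanSpace ℝ (Fin 3)) := by
    rw [hcdef]; exact congrArg Subtype.val hsymm0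
  have hcd0 : DifferentiableAt ℝ c 0 := (hcs 0 h0t).differentiableAt (by simp)
  -- `Dc(0)` is injective
  have hinj : Injective (fderiv ℝ c 0) := by
    have hψd : ψ.MDifferentiable (𝓡 2) (𝓡 2) :=
      ⟨hψ.mdifferentiableOn (by simp), hψs.mdifferentiableOn (by simp)⟩
    have h1 : Injective (mfderiv (𝓡 2) (𝓡 2) ψ.symm 0) := hψd.symm.mfderiv_injective h0t
    have h2 : Injective (mfderiv (𝓡 2) 𝓘(ℝ, EuclideanSpace ℝ (Fin 3))
        (Subtype.val : Metric.sphere (0 : EuclideanSpace ℝ (Fin 3)) 1 → EuclideanSpace ℝ (Fin 3))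
        (ψ.symm 0)) := mfderiv_coe_sphere_injective _
    have hcomp : HasMFDerivAt (𝓡 2) 𝓘(ℝ, EuclideanSpace ℝ (Fin 3)) c 0
        ((mfderiv (𝓡 2) 𝓘(ℝ, EuclideanSpace ℝ (Fin 3))
          (Subtype.val : Metric.sphere (0 : EuclideanSpace ℝ (Fin 3)) 1 →
            EuclideanSpace ℝ (Fin 3)) (ψ.symm 0)).comp (mfderiv (𝓡 2) (𝓡 2) ψ.symm 0)) :=
      ((contMDiff_coe_sphere (m := 1) _).mdifferentiableAt one_ne_zero).hasMFDerivAt.comp 0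
        ((hψd.symm.mdifferentiableAt h0t).hasMFDerivAt)
    have heq : fderiv ℝ c 0 = (mfderiv (𝓡 2) 𝓘(ℝ, EuclideanSpace ℝ (Fin 3))
          (Subtype.val : Metric.sphere (0 : EuclideanSpace ℝ (Fin 3)) 1 →
            EuclideanSpace ℝ (Fin 3)) (ψ.symm 0)).comp (mfderiv (𝓡 2) (𝓡 2) ψ.symm 0) := by
      rw [← mfderiv_eq_fderiv, hcomp.mfderiv]
    rw [heq]
    exact h2.comp h1
  -- the axis set of parameters, an open neighbourhood of `0`
  set U : Set ℝ := {t | t • a₀ ∈ φ.target} with hU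
  have hUo : IsOpen U := φ.open_target.preimage (continuous_id.smul continuous_const)
  have h0U : (0 : ℝ) ∈ U := by
    show (0 : ℝ) • a₀ ∈ φ.target
    rw [zero_smul, ← hφ0]; exact φ.map_source hq₀φ
  have hUn : U ∈ 𝓝 (0 : ℝ) := hUo.mem_nhds h0U
  -- the curve `k(t) = c(t e₀)` along the round image and its derivatives
  set k : ℝ → EuclideanSpace ℝ (Fin 3) := fun s => c (s • e₀) with hkdef
  have hk_at : ∀ t ∈ U, ContDiffAt ℝ ∞ k t := fun t ht => by
    have hg : ContDiffAt ℝ ∞ (fun s : ℝ => s • e₀) t := contDiffAt_id.smul contDiffAt_const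
    have hcomp : ContDiffAt ℝ ∞ (c ∘ fun s : ℝ => s • e₀) t :=
      (hcs (t • e₀) (haxis t ht).1).comp t hg
    exact hcomp
  have hk_on : ContDiffOn ℝ ∞ k U := fun t ht => (hk_at t ht).contDiffWithinAt
  have hk_deriv : ∀ t ∈ U, HasDerivAt k (fderiv ℝ c (t • e₀) e₀) t := fun t ht =>
    hasDerivAt_comp_smul_const ((hcs _ (haxis t ht).1).differentiableAt (by simp))
  have hk' : ∀ t ∈ U, HasDerivAt k (deriv k t) t := fun t ht =>
    (hk_deriv t ht).differentiableAt.hasDerivAt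
  have hdk_on : ContDiffOn ℝ ∞ (deriv k) U :=
    ((contDiffOn_infty_iff_deriv_of_isOpen hUo).1 hk_on).2
  have hdk0' : HasDerivAt (deriv k) (deriv (deriv k) 0) 0 :=
    ((hdk_on.differentiableOn (by simp)).differentiableAt hUn).hasDerivAt
  obtain ⟨T, hT⟩ : ∃ T, fderiv ℝ c 0 e₀ = T := ⟨_, rfl⟩
  obtain ⟨V, hV⟩ : ∃ V, fderiv ℝ c 0 e₁ = V := ⟨_, rfl⟩
  obtain ⟨W, hW⟩ : ∃ W, deriv (deriv k) 0 = W := ⟨_, rfl⟩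
  have hdk0 : HasDerivAt (deriv k) W 0 := hW ▸ hdk0'
  have hT' : deriv k 0 = T := by
    have := (hk_deriv 0 h0U).deriv; rwa [zero_smul, hT] at this
  have hk0 : k 0 = c 0 := by simp [hkdef]
  -- first-order consequences of `⟪c, c⟫ = 1`: `c 0 ⊥ Dc(0) d`
  have horth : ∀ d : EuclideanSpace ℝ (Fin 2), ⟪c 0, fderiv ℝ c 0 d⟫ = 0 := by
    intro d
    have hd0 : DifferentiableAt ℝ c ((0 : ℝ) • d) := by rw [zero_smul]; exact hcd0
    have hkd : HasDerivAt (fun s : ℝ => c (s • d)) (fderiv ℝ c ((0 : ℝ) • d) d) 0 :=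
      hasDerivAt_comp_smul_const hd0
    have hN := hkd.inner (𝕜 := ℝ) hkd
    have hconst : (fun s : ℝ => ⟪c (s • d), c (s • d)⟫) = fun _ => (1 : ℝ) := by
      funext s; exact hsphere _
    rw [hconst] at hN
    have h0 := hN.unique (hasDerivAt_const (0 : ℝ) (1 : ℝ))
    rw [zero_smul, real_inner_comm (c 0)] at h0
    linear_combination h0 / 2
  -- second-order consequence along the axis: `⟪c 0, W⟫ = -‖T‖²`
  have horth_on : ∀ t ∈ U, ⟪k t, deriv k t⟫ = 0 := by
    intro t ht
    have hN := (hk' t ht).inner (𝕜 := ℝ) (hk' t ht)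
    have hconst : (fun s : ℝ => ⟪k s, k s⟫) = fun _ => (1 : ℝ) := by
      funext s; exact hsphere _
    rw [hconst] at hN
    have h0 := hN.unique (hasDerivAt_const t (1 : ℝ))
    rw [real_inner_comm (k t)] at h0
    linear_combination h0 / 2
  have hsecond : ⟪c 0, W⟫ + ⟪T, T⟫ = 0 := by
    have hN := (hk' 0 h0U).inner (𝕜 := ℝ) hdk0
    have hzero : (fun s : ℝ => ⟪k s, deriv k s⟫) =ᶠ[𝓝 0] fun _ => (0 : ℝ) :=
      Filter.eventuallyEq_of_mem hUn fun t ht => horth_on t ht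
    have h1 : deriv (fun s : ℝ => ⟪k s, deriv k s⟫) 0 = 0 := by
      rw [hzero.deriv_eq, deriv_const]
    rw [hN.deriv, hT', hk0] at h1
    exact h1
  -- the third coordinate vanishes along the axis, to all orders
  have hz_on : ∀ t ∈ U, ⟪E2, k t⟫ = 0 := fun t ht => by
    rw [← apply_eq_inner_single]; exact (haxis t ht).2
  have hzT_on : ∀ t ∈ U, ⟪E2, deriv k t⟫ = 0 := by
    intro t ht
    have h1 := ((hasDerivAt_const t E2).inner (𝕜 := ℝ) (hk' t ht)).deriv
    have hzero : (fun s : ℝ => ⟪E2, k s⟫) =ᶠ[𝓝 t] fun _ => (0 : ℝ) :=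
      Filter.eventuallyEq_of_mem (hUo.mem_nhds ht) fun s hs => hz_on s hs
    rw [hzero.deriv_eq, deriv_const] at h1
    simp only [inner_zero_left, add_zero] at h1
    exact h1.symm
  have hzT : T 2 = 0 := by rw [apply_eq_inner_single, ← hT']; exact hzT_on 0 h0U
  have hzW : W 2 = 0 := by
    have h1 := ((hasDerivAt_const (0 : ℝ) E2).inner (𝕜 := ℝ) hdk0).deriv
    have hzero : (fun s : ℝ => ⟪E2, deriv k s⟫) =ᶠ[𝓝 0] fun _ => (0 : ℝ) :=
      Filter.eventuallyEq_of_mem hUn fun s hs => hzT_on s hs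
    rw [hzero.deriv_eq, deriv_const] at h1
    simp only [inner_zero_left, add_zero] at h1
    rw [apply_eq_inner_single]; exact h1.symm
  -- coordinates of `f q₀ = c 0 = (x₀, y₀, 0)`
  have hz₀ : (c 0) 2 = 0 := by
    have := (haxis 0 h0U).2
    rwa [zero_smul] at this
  have hxy : (c 0) 0 ^ 2 + (c 0) 1 ^ 2 = 1 := by
    have h1 := hsphere 0
    rw [inner_fin_three, hz₀] at h1
    linear_combination h1
  have hTorth : (c 0) 0 * T 0 + (c 0) 1 * T 1 = 0 := by
    have h1 := horth e₀
    rw [hT, inner_fin_three, hz₀] at h1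
    linear_combination h1
  have hVorth : (c 0) 0 * V 0 + (c 0) 1 * V 1 = 0 := by
    have h1 := horth e₁
    rw [hV, inner_fin_three, hz₀] at h1
    linear_combination h1
  have hT0 : T ≠ 0 := by
    intro hT0
    have h0 : fderiv ℝ c 0 e₀ = fderiv ℝ c 0 0 := by rw [map_zero, hT, hT0]
    have h1 := congrArg (fun v : EuclideanSpace ℝ (Fin 2) => v 0) (hinj h0)
    simp [he₀] at h1
  -- `T₁ ≠ 0` as soon as `T₀ = 0`
  have hT1_of : T 0 = 0 → T 1 ≠ 0 := by
    intro hT00 hT10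
    apply hT0
    ext i; fin_cases i
    · exact hT00
    · exact hT10
    · exact hzT
  -- the derivatives of `Λ ∘ c` at `0` in the fold-chart directions
  have hfirst : ∀ (Λ : EuclideanSpace ℝ (Fin 3) →L[ℝ] ℝ) (d : EuclideanSpace ℝ (Fin 2)),
      fderiv ℝ ((fun w : Metric.sphere (0 : EuclideanSpace ℝ (Fin 3)) 1 => Λ w) ∘ ψ.symm) 0 d =
        Λ (fderiv ℝ c 0 d) := by
    intro Λ d
    have h1 : HasFDerivAt ((fun w : Metric.sphere (0 : EuclideanSpace ℝ (Fin 3)) 1 => Λ w) ∘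
        ψ.symm) (Λ.comp (fderiv ℝ c 0)) 0 := Λ.hasFDerivAt.comp 0 hcd0.hasFDerivAt
    rw [h1.fderiv]; rfl
  have hsecondΛ : ∀ (Λ : EuclideanSpace ℝ (Fin 3) →L[ℝ] ℝ),
      fderiv ℝ (fderiv ℝ ((fun w : Metric.sphere (0 : EuclideanSpace ℝ (Fin 3)) 1 => Λ w) ∘
        ψ.symm)) 0 e₀ e₀ = Λ W := by
    intro Λ
    have h2 : ContDiffAt ℝ 2 ((fun w : Metric.sphere (0 : EuclideanSpace ℝ (Fin 3)) 1 => Λ w) ∘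
        ψ.symm) 0 :=
      (contDiffAt_comp_symm_of_chart hψs (contMDiff_apply_sphere Λ) h0t).of_le (by norm_cast)
    rw [← deriv_deriv_comp_smul_const h2]
    -- `s ↦ Λ (k s)` has derivative `Λ (k' s)` on `U`, and that has derivative `Λ W` at `0`
    have hd1 : deriv (fun s : ℝ => ((fun w : Metric.sphere (0 : EuclideanSpace ℝ (Fin 3)) 1 =>
        Λ w) ∘ ψ.symm) (s • e₀)) =ᶠ[𝓝 0] fun s => Λ (deriv k s) := by
      refine Filter.eventuallyEq_of_mem hUn fun t ht => ?_
      exact (Λ.hasFDerivAt.comp_hasDerivAt t (hk' t ht)).deriv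
    rw [hd1.deriv_eq]
    exact (Λ.hasFDerivAt.comp_hasDerivAt (0 : ℝ) hdk0).deriv
  refine ⟨hc0 ▸ hz₀, fun ε Λ hε hΛ => ?_, ?_⟩
  · -- criticality: `∂ₜ(Λ ∘ ψ⁻¹)(0) = Λ T = ε T₀` vanishes iff `y₀ = 0`
    rw [isMCriticalPt_comp_iff_of_fold_chart hmaps hφ hφs hψs hmodel hf.contMDiff
      (contMDiff_apply_sphere Λ) hq₀φ haxis0, hψf0, hfirst Λ e₀, hT, hΛ, hzT, zero_add, ← hc0]
    rw [mul_eq_zero, or_iff_right hε]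
    constructor
    · intro hT00
      have h1 := hT1_of hT00
      rw [hT00, mul_zero, zero_add] at hTorth
      exact (mul_eq_zero.1 hTorth).resolve_right h1
    · intro hy00
      rw [hy00] at hxy hTorth
      have hx2 : (c 0) 0 ^ 2 = 1 := by linear_combination hxy
      have hx : (c 0) 0 ≠ 0 := fun h0 => by rw [h0] at hx2; norm_num at hx2
      have h2 : (c 0) 0 * T 0 = 0 := by linear_combination hTorth
      exact (mul_eq_zero.1 h2).resolve_left hx
  · -- index at a critical round point
    refine ⟨if 0 < V 2 then 1 else 2, by split_ifs <;> simp, fun ε Λ hε hΛ hy00 => ?_⟩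
    have hy0 : (c 0) 1 = 0 := by rw [hc0]; exact hy00
    rw [hy0] at hxy hTorth hVorth
    have hx2 : (c 0) 0 ^ 2 = 1 := by linear_combination hxy
    have hx : (c 0) 0 ≠ 0 := fun h0 => by rw [h0] at hx2; norm_num at hx2
    have hT00 : T 0 = 0 := by
      have h2 : (c 0) 0 * T 0 = 0 := by linear_combination hTorth
      exact (mul_eq_zero.1 h2).resolve_left hx
    have hT1 : T 1 ≠ 0 := hT1_of hT00
    have hV0 : V 0 = 0 := by
      have h2 : (c 0) 0 * V 0 = 0 := by linear_combination hVorth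
      exact (mul_eq_zero.1 h2).resolve_left hx
    have hV2 : V 2 ≠ 0 := by
      intro hV2
      -- `V = (V₁/T₁) T`, contradicting the injectivity of `Dc(0)`
      obtain ⟨r, hr⟩ : ∃ r : ℝ, V 1 / T 1 = r := ⟨_, rfl⟩
      have hVT : V = r • T := by
        ext i; fin_cases i
        · simp [hV0, hT00]
        · show V 1 = r * T 1
          rw [← hr]; field_simp
        · simp [hV2, hzT]
      have h1 : fderiv ℝ c 0 (e₁ - r • e₀) = fderiv ℝ c 0 0 := by
        rw [map_sub, map_smul, hV, hT, hVT, sub_self, map_zero]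
      have h3 := congrArg (fun v : EuclideanSpace ℝ (Fin 2) => v 1) (hinj h1)
      simp [he₀, he₁] at h3
    have hW0 : W 0 = -(c 0) 0 * (T 1) ^ 2 := by
      have h1 := hsecond
      rw [inner_fin_three, inner_fin_three, hz₀, hy0, hT00, hzT] at h1
      have h3 : (c 0) 0 * W 0 = -(T 1) ^ 2 := by linear_combination h1
      linear_combination (c 0) 0 * h3 - W 0 * hx2
    -- the quantities `α`, `β` of the fold-chart index formula
    have hα : fderiv ℝ (fderiv ℝ ((fun w : Metric.sphere (0 : EuclideanSpace ℝ (Fin 3)) 1 =>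
        Λ w) ∘ ψ.symm)) (ψ (f q₀)) e₀ e₀ = -(ε * (c 0) 0) * (T 1) ^ 2 := by
      rw [hψf0, hsecondΛ Λ, hΛ, hzW, hW0]; ring
    have hβ : fderiv ℝ ((fun w : Metric.sphere (0 : EuclideanSpace ℝ (Fin 3)) 1 => Λ w) ∘
        ψ.symm) (ψ (f q₀)) e₁ = V 2 := by
      rw [hψf0, hfirst Λ e₁, hV, hΛ, hV0, mul_zero, add_zero]
    have hcrit : IsMCriticalPt (𝓡 4)
        ((fun w : Metric.sphere (0 : EuclideanSpace ℝ (Fin 3)) 1 => Λ w) ∘ f) q₀ := by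
      rw [isMCriticalPt_comp_iff_of_fold_chart hmaps hφ hφs hψs hmodel hf.contMDiff
        (contMDiff_apply_sphere Λ) hq₀φ haxis0, hψf0, hfirst Λ e₀, hT, hΛ, hzT, hT00]
      simp
    have hT1sq : 0 < (T 1) ^ 2 := by positivity
    have hαne : fderiv ℝ (fderiv ℝ ((fun w : Metric.sphere (0 : EuclideanSpace ℝ (Fin 3)) 1 =>
        Λ w) ∘ ψ.symm)) (ψ (f q₀)) e₀ e₀ ≠ 0 := by
      rw [hα]
      exact mul_ne_zero (neg_ne_zero.2 (mul_ne_zero hε hx)) hT1sq.ne'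
    have hβne : fderiv ℝ ((fun w : Metric.sphere (0 : EuclideanSpace ℝ (Fin 3)) 1 => Λ w) ∘
        ψ.symm) (ψ (f q₀)) e₁ ≠ 0 := by rw [hβ]; exact hV2
    obtain ⟨hnd, hidx⟩ := nondegenerate_and_morseIndex_comp_of_fold_chart hmaps hφ hφs hψs hmodel
      hf.contMDiff (contMDiff_apply_sphere Λ) hq₀φ haxis0 hcrit hαne hβne
    refine ⟨hnd, ?_⟩
    rw [hidx, hα, hβ]
    have hx0' : ((f q₀ : Metric.sphere (0 : EuclideanSpace ℝ (Fin 3)) 1) :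
        EuclideanSpace ℝ (Fin 3)) 0 = (c 0) 0 := by rw [hc0]
    rw [hx0']
    have hiff : -(ε * (c 0) 0) * T 1 ^ 2 < 0 ↔ 0 < ε * (c 0) 0 := by
      rw [neg_mul, neg_lt_zero]
      exact mul_pos_iff_of_pos_right hT1sq
    by_cases hpos : 0 < ε * (c 0) 0
    · rw [if_pos (hiff.2 hpos), if_pos hpos]
    · rw [if_neg (fun h' => hpos (hiff.1 h')), if_neg hpos]

omit [IsManifold (𝓡 4) ∞ X] in
/-- **The round points over `(±1, 0, 0)`.**  If the round image is the equator, there is a round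
point `p` with `f p = (s, 0, 0)` for `s = ±1`. [cite: Baykur2012, Lemma 7] -/
theorem exists_round_point_over
    (hC : f '' ({p : X | ¬ Surjective (mfderiv (𝓡 4) (𝓡 2) f p)} \ (↑L : Set X)) =
      sphereEquator 1) {s : ℝ} (hs : s = 1 ∨ s = -1) :
    ∃ p : X, ¬ Surjective (mfderiv (𝓡 4) (𝓡 2) f p) ∧ p ∉ L ∧
      ((f p : Metric.sphere (0 : EuclideanSpace ℝ (Fin 3)) 1) : EuclideanSpace ℝ (Fin 3)) 0 = s ∧
      ((f p : Metric.sphere (0 : EuclideanSpace ℝ (Fin 3)) 1) : EuclideanSpace ℝ (Fin 3)) 1 = 0 ∧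
      ((f p : Metric.sphere (0 : EuclideanSpace ℝ (Fin 3)) 1) : EuclideanSpace ℝ (Fin 3)) 2 = 0 := by
  have hs1 : ‖(EuclideanSpace.single (0 : Fin 3) s : EuclideanSpace ℝ (Fin 3))‖ = 1 := by
    rw [PiLp.norm_single, Real.norm_eq_abs]
    rcases hs with rfl | rfl <;> norm_num
  set v : Metric.sphere (0 : EuclideanSpace ℝ (Fin 3)) 1 :=
    ⟨EuclideanSpace.single 0 s, by rw [mem_sphere_zero_iff_norm]; exact hs1⟩ with hv
  have hvC : v ∈ sphereEquator 1 := by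
    rw [mem_sphereEquator_iff]
    show (EuclideanSpace.single (0 : Fin 3) s : EuclideanSpace ℝ (Fin 3)) (Fin.last 2) = 0
    simp
  rw [← hC] at hvC
  obtain ⟨p, ⟨hp, hpL⟩, hfp⟩ := hvC
  refine ⟨p, hp, fun h' => hpL (Finset.mem_coe.2 h'), ?_, ?_, ?_⟩ <;>
    simp [hfp, hv]

omit [IsManifold (𝓡 4) ∞ X] in
/-- **Critical values of `f`.**  With equatorial round image, a critical value `v` of `f` is a
Lefschetz value or lies on the equator, where `|Λ_ε v| = |ε v₀| ≤ |ε|`. [cite: Baykur2012, Lemma 7] -/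
theorem mem_image_or_abs_apply_le_of_not_regular
    (hC : f '' ({p : X | ¬ Surjective (mfderiv (𝓡 4) (𝓡 2) f p)} \ (↑L : Set X)) =
      sphereEquator 1) {ε : ℝ} (Λ : EuclideanSpace ℝ (Fin 3) →L[ℝ] ℝ)
    (hΛ : ∀ x, Λ x = x 2 + ε * x 0) {v : Metric.sphere (0 : EuclideanSpace ℝ (Fin 3)) 1}
    (hv : ¬ ∀ q, f q = v → Surjective (mfderiv (𝓡 4) (𝓡 2) f q)) :
    v ∈ f '' (↑L : Set X) ∨ |Λ v| ≤ |ε| := by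
  push Not at hv
  obtain ⟨q, rfl, hq⟩ := hv
  by_cases hqL : q ∈ L
  · exact Or.inl (mem_image_of_mem f (Finset.mem_coe.2 hqL))
  · right
    have hmem : f q ∈ sphereEquator 1 := by
      rw [← hC]; exact mem_image_of_mem f ⟨hq, fun h' => hqL (Finset.mem_coe.1 h')⟩
    have h2 : ((f q : Metric.sphere (0 : EuclideanSpace ℝ (Fin 3)) 1) : EuclideanSpace ℝ (Fin 3)) 2
        = 0 := (mem_sphereEquator_iff _).1 hmem
    have h0 : |((f q : Metric.sphere (0 : EuclideanSpace ℝ (Fin 3)) 1) :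
        EuclideanSpace ℝ (Fin 3)) 0| ≤ 1 := by
      have h1 := abs_real_inner_le_norm (EuclideanSpace.single (0 : Fin 3) (1 : ℝ))
        ((f q : Metric.sphere (0 : EuclideanSpace ℝ (Fin 3)) 1) : EuclideanSpace ℝ (Fin 3))
      rw [← apply_eq_inner_single, norm_eq_of_mem_sphere, PiLp.norm_single, norm_one,
        one_mul] at h1
      exact h1
    rw [hΛ, h2, zero_add, abs_mul]
    exact mul_le_of_le_one_right (abs_nonneg ε) h0

/-- The vector `n = (ε, 0, 1)` representing `Λ_ε = v₂ + ε v₀`: `Λ_ε = ⟪n, ·⟫` and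
`‖n‖² = 1 + ε²`. [folklore] -/
theorem exists_inner_repr_height {ε : ℝ} (Λ : EuclideanSpace ℝ (Fin 3) →L[ℝ] ℝ)
    (hΛ : ∀ x, Λ x = x 2 + ε * x 0) :
    ∃ n₀ : EuclideanSpace ℝ (Fin 3), (∀ x, Λ x = ⟪n₀, x⟫) ∧ ‖n₀‖ ^ 2 = 1 + ε ^ 2 := by
  refine ⟨EuclideanSpace.single 2 1 + ε • EuclideanSpace.single 0 1, fun x => ?_, ?_⟩
  · rw [inner_add_left, real_inner_smul_left, ← apply_eq_inner_single, ← apply_eq_inner_single, hΛ]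
  · rw [← real_inner_self_eq_norm_sq, inner_fin_three]
    simp
    ring

/-- **The critical points of the tilted height `Λ_ε ∘ f`** (`ε ≠ 0`, equatorial round image) are
of three kinds: Lefschetz points; round points over `(±1, 0, 0)`; regular points of `f` over the
two poles of `Λ_ε`, where `(Λ_ε ∘ f)² = 1 + ε²`. [cite: Baykur2012, Lemma 7] [cite: Milnor1963, §2] -/
theorem isMCriticalPt_height_cases (hf : IsSimplifiedBrokenLefschetzFibration o f L h)
    (hC : f '' ({p : X | ¬ Surjective (mfderiv (𝓡 4) (𝓡 2) f p)} \ (↑L : Set X)) =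
      sphereEquator 1) {ε : ℝ} (hε : ε ≠ 0) (Λ : EuclideanSpace ℝ (Fin 3) →L[ℝ] ℝ)
    (hΛ : ∀ x, Λ x = x 2 + ε * x 0) {q : X}
    (hq : IsMCriticalPt (𝓡 4)
      ((fun w : Metric.sphere (0 : EuclideanSpace ℝ (Fin 3)) 1 => Λ w) ∘ f) q) :
    q ∈ L ∨
      (¬ Surjective (mfderiv (𝓡 4) (𝓡 2) f q) ∧ q ∉ L ∧
        ((f q : Metric.sphere (0 : EuclideanSpace ℝ (Fin 3)) 1) : EuclideanSpace ℝ (Fin 3)) 1 = 0 ∧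
        ((f q : Metric.sphere (0 : EuclideanSpace ℝ (Fin 3)) 1) : EuclideanSpace ℝ (Fin 3)) 2 = 0) ∨
      (Surjective (mfderiv (𝓡 4) (𝓡 2) f q) ∧ (Λ (f q)) ^ 2 = 1 + ε ^ 2) := by
  by_cases hqL : q ∈ L
  · exact Or.inl hqL
  by_cases hs : Surjective (mfderiv (𝓡 4) (𝓡 2) f q)
  · right; right
    refine ⟨hs, ?_⟩
    have h0 := (isMCriticalPt_comp_iff_of_surjective_mfderiv
      ((hf.contMDiff q).mdifferentiableAt (by simp))
      ((contMDiff_apply_sphere Λ _).mdifferentiableAt (by simp)) hs).1 hq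
    obtain ⟨n₀, hn₀, hnorm⟩ := exists_inner_repr_height Λ hΛ
    rcases apply_eq_norm_or_of_mfderiv_eq_zero n₀ Λ hn₀ (f q) h0 with h1 | h1 <;>
      rw [h1] <;> simp [hnorm]
  · right; left
    obtain ⟨h2, hcrit, -⟩ := round_point_height hf hC hs hqL
    exact ⟨hs, hqL, (hcrit ε Λ hε hΛ).1 hq, h2⟩

/-- **Nondegeneracy of the tilted height away from the poles**: a critical point `q` of
`Λ_ε ∘ f` with `(Λ_ε (f q))² ≠ 1 + ε²` is nondegenerate (a Lefschetz point, of index `2`, or a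
round point over `(±1, 0, 0)`). [cite: Baykur2012, Lemma 7] [cite: Milnor1963, §2] -/
theorem nondegenerate_height (hf : IsSimplifiedBrokenLefschetzFibration o f L h)
    (hC : f '' ({p : X | ¬ Surjective (mfderiv (𝓡 4) (𝓡 2) f p)} \ (↑L : Set X)) =
      sphereEquator 1) {ε : ℝ} (hε : ε ≠ 0) (Λ : EuclideanSpace ℝ (Fin 3) →L[ℝ] ℝ)
    (hΛ : ∀ x, Λ x = x 2 + ε * x 0) {q : X}
    (hq : IsMCriticalPt (𝓡 4)
      ((fun w : Metric.sphere (0 : EuclideanSpace ℝ (Fin 3)) 1 => Λ w) ∘ f) q)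
    (hval : (Λ (f q)) ^ 2 ≠ 1 + ε ^ 2) :
    (mhessian (𝓡 4)
      ((fun w : Metric.sphere (0 : EuclideanSpace ℝ (Fin 3)) 1 => Λ w) ∘ f) q).Nondegenerate := by
  rcases isMCriticalPt_height_cases hf hC hε Λ hΛ hq with hqL | ⟨hs, hqL, h1, -⟩ | ⟨-, h⟩
  · -- Lefschetz point: `dΛ_{f q} ≠ 0` since `f q` is not a pole
    obtain ⟨c, -⟩ := hf.lefschetz q hqL
    have hℓq : mfderiv (𝓡 2) 𝓘(ℝ, ℝ)
        (fun w : Metric.sphere (0 : EuclideanSpace ℝ (Fin 3)) 1 => Λ w) (f q) ≠ 0 := by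
      intro h0
      obtain ⟨n₀, hn₀, hnorm⟩ := exists_inner_repr_height Λ hΛ
      apply hval
      rcases apply_eq_norm_or_of_mfderiv_eq_zero n₀ Λ hn₀ (f q) h0 with h1 | h1 <;>
        rw [h1] <;> simp [hnorm]
    exact (isMCriticalPt_nondegenerate_morseIndex_comp_of_lefschetzChart c hf.contMDiff
      (contMDiff_apply_sphere Λ) hℓq).2.1
  · obtain ⟨-, -, σ, -, hidx⟩ := round_point_height hf hC hs hqL
    exact (hidx ε Λ hε hΛ h1).1
  · exact absurd h hval

/-- **Lefschetz points are critical of index `2` for the tilted height** when their values are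
not poles. [cite: Milnor1963, §2] -/
theorem isMCriticalPt_and_morseIndex_height_of_mem
    (hf : IsSimplifiedBrokenLefschetzFibration o f L h) {ε : ℝ}
    (Λ : EuclideanSpace ℝ (Fin 3) →L[ℝ] ℝ) (hΛ : ∀ x, Λ x = x 2 + ε * x 0) {q : X} (hqL : q ∈ L)
    (hval : (Λ (f q)) ^ 2 ≠ 1 + ε ^ 2) :
    IsMCriticalPt (𝓡 4) ((fun w : Metric.sphere (0 : EuclideanSpace ℝ (Fin 3)) 1 => Λ w) ∘ f) q ∧
      morseIndex (𝓡 4) ((fun w : Metric.sphere (0 : EuclideanSpace ℝ (Fin 3)) 1 => Λ w) ∘ f) q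
        = 2 := by
  obtain ⟨c, -⟩ := hf.lefschetz q hqL
  have hℓq : mfderiv (𝓡 2) 𝓘(ℝ, ℝ)
      (fun w : Metric.sphere (0 : EuclideanSpace ℝ (Fin 3)) 1 => Λ w) (f q) ≠ 0 := by
    intro h0
    obtain ⟨n₀, hn₀, hnorm⟩ := exists_inner_repr_height Λ hΛ
    apply hval
    rcases apply_eq_norm_or_of_mfderiv_eq_zero n₀ Λ hn₀ (f q) h0 with h1 | h1 <;>
      rw [h1] <;> simp [hnorm]
  have h := isMCriticalPt_nondegenerate_morseIndex_comp_of_lefschetzChart c hf.contMDiff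
    (contMDiff_apply_sphere Λ) hℓq
  exact ⟨h.1, h.2.2⟩

/-! ### The signed Morse count of the tilted height between the polar caps -/

/-- Counting a finite set by the fibres of `ι` with signs: `Σₖ (-1)ᵏ #{q ∈ S | ι q = k} =
Σ_{q ∈ S} (-1)^{ι q}` when all `ι q < N`. [folklore] -/
theorem sum_neg_one_pow_mul_card_filter {α : Type*} (S : Finset α) (ι : α → ℕ) {N : ℕ}
    (hN : ∀ q ∈ S, ι q < N) :
    ∑ k ∈ Finset.range N, (-1 : ℤ) ^ k * ((S.filter fun q => ι q = k).card : ℤ) =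
      ∑ q ∈ S, (-1 : ℤ) ^ (ι q) := by
  classical
  have h1 : ∀ k, ((S.filter fun q => ι q = k).card : ℤ) =
      ∑ q ∈ S, if ι q = k then (1 : ℤ) else 0 := by
    intro k
    rw [Finset.card_filter, Nat.cast_sum]
    refine Finset.sum_congr rfl fun q _ => ?_
    split_ifs <;> simp
  simp_rw [h1, Finset.mul_sum]
  rw [Finset.sum_comm]
  refine Finset.sum_congr rfl fun q hq => ?_
  rw [Finset.sum_eq_single (ι q)]
  · simp
  · intro k _ hk
    simp [Ne.symm hk]
  · intro h'
    exact absurd (Finset.mem_range.2 (hN q hq)) h'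

omit [IsManifold (𝓡 4) ∞ X] in
/-- **The signed Morse count on a slab from a classification of its critical points**: if the
critical points of `g` with value in `(-c, c)` are exactly the points of the finite set `S`, all
of index `< N`, then `Σ_{k<N} (-1)ᵏ #(critₖ(g) ∩ g⁻¹(-c, c)) = Σ_{q ∈ S} (-1)^{index q}`.
[folklore] -/
theorem morseCount_slab_eq_sum {g : X → ℝ} {c : ℝ} (S : Finset X)
    (hS : ∀ q, (IsMCriticalPt (𝓡 4) g q ∧ g q ∈ Ioo (-c) c) ↔ q ∈ S) {N : ℕ}
    (hN : ∀ q ∈ S, morseIndex (𝓡 4) g q < N) :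
    ∑ k ∈ Finset.range N, (-1 : ℤ) ^ k *
        ((criticalSetOfIndex (𝓡 4) g k ∩ g ⁻¹' Ioo (-c) c).ncard : ℤ) =
      ∑ q ∈ S, (-1 : ℤ) ^ morseIndex (𝓡 4) g q := by
  classical
  have hset : ∀ k, criticalSetOfIndex (𝓡 4) g k ∩ g ⁻¹' Ioo (-c) c =
      ↑(S.filter fun q => morseIndex (𝓡 4) g q = k) := by
    intro k; ext q
    simp only [mem_inter_iff, mem_criticalSetOfIndex, mem_preimage, Finset.coe_filter,
      mem_setOf_eq]
    constructor
    · rintro ⟨⟨hc, hk⟩, hv⟩; exact ⟨(hS q).1 ⟨hc, hv⟩, hk⟩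
    · rintro ⟨hq, hk⟩
      obtain ⟨hc, hv⟩ := (hS q).2 hq
      exact ⟨⟨hc, hk⟩, hv⟩
  simp_rw [hset, Set.ncard_coe_finset]
  exact sum_neg_one_pow_mul_card_filter S _ hN

/-- **The signed Morse counts of `Λ_ε ∘ f` and `Λ_{-ε} ∘ f` between the polar caps add up to
`2 #L`** (the quantitative core of Baykur 2012, Lemma 7, for the tilted heights).  Hypotheses:
`f` an SBLF with equatorial round image, `ε ≠ 0`, and a level `c` with `|ε| < c`,
`c² < 1 + ε²` and `|Λ_{±ε} (f p)| < c` for the Lefschetz points `p`.  Then the critical points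
of `Λ_{±ε} ∘ f` with value in `(-c, c)` are the Lefschetz points (index `2`) and the two round
points over `(±1, 0, 0)`, whose indices have opposite parities for `ε` and `-ε`
(`round_point_height`); so the two signed counts `Σₖ (-1)ᵏ #critₖ` add up to `2 #L`.
[cite: Baykur2012, Lemma 7] [cite: Milnor1963, §2] -/
theorem morseCount_height_add_morseCount_height_neg
    (hf : IsSimplifiedBrokenLefschetzFibration o f L h)
    (hC : f '' ({p : X | ¬ Surjective (mfderiv (𝓡 4) (𝓡 2) f p)} \ (↑L : Set X)) =
      sphereEquator 1) {ε : ℝ} (hε : ε ≠ 0)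
    (Λ₁ Λ₂ : EuclideanSpace ℝ (Fin 3) →L[ℝ] ℝ) (hΛ₁ : ∀ x, Λ₁ x = x 2 + ε * x 0)
    (hΛ₂ : ∀ x, Λ₂ x = x 2 + (-ε) * x 0) {c : ℝ} (hεc : |ε| < c) (hc : c ^ 2 < 1 + ε ^ 2)
    (hL₁ : ∀ p ∈ L, |Λ₁ (f p)| < c) (hL₂ : ∀ p ∈ L, |Λ₂ (f p)| < c) :
    (∑ k ∈ Finset.range 6, (-1 : ℤ) ^ k *
        ((criticalSetOfIndex (𝓡 4)
            ((fun w : Metric.sphere (0 : EuclideanSpace ℝ (Fin 3)) 1 => Λ₁ w) ∘ f) k ∩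
          ((fun w : Metric.sphere (0 : EuclideanSpace ℝ (Fin 3)) 1 => Λ₁ w) ∘ f) ⁻¹' Ioo (-c) c).ncard
            : ℤ)) +
      (∑ k ∈ Finset.range 6, (-1 : ℤ) ^ k *
        ((criticalSetOfIndex (𝓡 4)
            ((fun w : Metric.sphere (0 : EuclideanSpace ℝ (Fin 3)) 1 => Λ₂ w) ∘ f) k ∩
          ((fun w : Metric.sphere (0 : EuclideanSpace ℝ (Fin 3)) 1 => Λ₂ w) ∘ f) ⁻¹' Ioo (-c) c).ncard
            : ℤ)) = 2 * (L.card : ℤ) := by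
  classical
  -- the two critical round points
  obtain ⟨p₁, hp₁, hp₁L, hx₁, hy₁, hz₁⟩ := exists_round_point_over hC (s := 1) (Or.inl rfl)
  obtain ⟨p₂, hp₂, hp₂L, hx₂, hy₂, hz₂⟩ := exists_round_point_over hC (s := -1) (Or.inr rfl)
  have hp₁₂ : p₁ ≠ p₂ := by
    intro he; rw [he, hx₂] at hx₁; norm_num at hx₁
  obtain ⟨-, hcrit₁, σ₁, hσ₁, hidx₁⟩ := round_point_height hf hC hp₁ hp₁L
  obtain ⟨-, hcrit₂, σ₂, hσ₂, hidx₂⟩ := round_point_height hf hC hp₂ hp₂L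
  set S : Finset X := insert p₁ (insert p₂ L) with hSdef
  have hp₁S : p₁ ∉ insert p₂ L := by
    rw [Finset.mem_insert, not_or]; exact ⟨hp₁₂, hp₁L⟩
  -- a round point `q` with `(f q)₁ = (f q)₂ = 0` is `p₁` or `p₂`
  have hround : ∀ q, ¬ Surjective (mfderiv (𝓡 4) (𝓡 2) f q) →
      ((f q : Metric.sphere (0 : EuclideanSpace ℝ (Fin 3)) 1) : EuclideanSpace ℝ (Fin 3)) 1 = 0 →
      ((f q : Metric.sphere (0 : EuclideanSpace ℝ (Fin 3)) 1) : EuclideanSpace ℝ (Fin 3)) 2 = 0 →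
      q = p₁ ∨ q = p₂ := by
    intro q hq h1 h2
    have hn := norm_eq_of_mem_sphere (f q)
    have hsq : ((f q : Metric.sphere (0 : EuclideanSpace ℝ (Fin 3)) 1) : EuclideanSpace ℝ (Fin 3)) 0
        ^ 2 = 1 := by
      have h3 : ⟪((f q : Metric.sphere (0 : EuclideanSpace ℝ (Fin 3)) 1) : EuclideanSpace ℝ (Fin 3)),
          ((f q : Metric.sphere (0 : EuclideanSpace ℝ (Fin 3)) 1) : EuclideanSpace ℝ (Fin 3))⟫ = 1 := by
        rw [real_inner_self_eq_norm_sq, hn]; norm_num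
      rw [inner_fin_three, h1, h2] at h3
      linear_combination h3
    have hx : ((f q : Metric.sphere (0 : EuclideanSpace ℝ (Fin 3)) 1) : EuclideanSpace ℝ (Fin 3)) 0
        = 1 ∨
        ((f q : Metric.sphere (0 : EuclideanSpace ℝ (Fin 3)) 1) : EuclideanSpace ℝ (Fin 3)) 0 = -1 := by
      have : (((f q : Metric.sphere (0 : EuclideanSpace ℝ (Fin 3)) 1) : EuclideanSpace ℝ (Fin 3)) 0
          - 1) * (((f q : Metric.sphere (0 : EuclideanSpace ℝ (Fin 3)) 1) :
            EuclideanSpace ℝ (Fin 3)) 0 + 1) = 0 := by linear_combination hsq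
      rcases mul_eq_zero.1 this with h' | h'
      · left; linarith
      · right; linarith
    have heq : ∀ p : X,
        ((f p : Metric.sphere (0 : EuclideanSpace ℝ (Fin 3)) 1) : EuclideanSpace ℝ (Fin 3)) 0 =
          ((f q : Metric.sphere (0 : EuclideanSpace ℝ (Fin 3)) 1) : EuclideanSpace ℝ (Fin 3)) 0 →
        ((f p : Metric.sphere (0 : EuclideanSpace ℝ (Fin 3)) 1) : EuclideanSpace ℝ (Fin 3)) 1 = 0 →
        ((f p : Metric.sphere (0 : EuclideanSpace ℝ (Fin 3)) 1) : EuclideanSpace ℝ (Fin 3)) 2 = 0 →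
        f p = f q := by
      intro p h0 h1' h2'
      apply Subtype.ext
      ext i; fin_cases i
      · exact h0
      · exact h1'.trans h1.symm
      · exact h2'.trans h2.symm
    rcases hx with h0 | h0
    · left
      exact (hf.injOn_crit hq hp₁ ((heq p₁ (hx₁.trans h0.symm) hy₁ hz₁).symm)).symm ▸ rfl
    · right
      exact (hf.injOn_crit hq hp₂ ((heq p₂ (hx₂.trans h0.symm) hy₂ hz₂).symm)).symm ▸ rfl
  -- classification of the critical points with value in `(-c, c)`, for `±ε`
  have hclass : ∀ (ε' : ℝ) (Λ' : EuclideanSpace ℝ (Fin 3) →L[ℝ] ℝ), ε' ≠ 0 → ε' ^ 2 = ε ^ 2 →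
      |ε'| < c → (∀ x, Λ' x = x 2 + ε' * x 0) → (∀ p ∈ L, |Λ' (f p)| < c) →
      ∀ q, (IsMCriticalPt (𝓡 4)
          ((fun w : Metric.sphere (0 : EuclideanSpace ℝ (Fin 3)) 1 => Λ' w) ∘ f) q ∧
        (((fun w : Metric.sphere (0 : EuclideanSpace ℝ (Fin 3)) 1 => Λ' w) ∘ f) q ∈ Ioo (-c) c))
        ↔ q ∈ S := by
    intro ε' Λ' hε' hε'2 hε'c hΛ' hL' q
    have hval_of_lt : ∀ p, |Λ' (f p)| < c → (Λ' (f p)) ^ 2 ≠ 1 + ε' ^ 2 := by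
      intro p hp heq
      have h1 : (Λ' (f p)) ^ 2 < c ^ 2 := by
        have := abs_nonneg (Λ' (f p))
        nlinarith [sq_abs (Λ' (f p)), hp]
      rw [heq, hε'2] at h1
      linarith
    constructor
    · rintro ⟨hcq, hvq⟩
      have habs : |Λ' (f q)| < c := abs_lt.2 hvq
      rcases isMCriticalPt_height_cases hf hC hε' Λ' hΛ' hcq with hqL | ⟨hs, -, h1, h2⟩ | ⟨-, hv⟩
      · exact Finset.mem_insert_of_mem (Finset.mem_insert_of_mem hqL)
      · rcases hround q hs h1 h2 with rfl | rfl
        · exact Finset.mem_insert_self _ _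
        · exact Finset.mem_insert_of_mem (Finset.mem_insert_self _ _)
      · exact absurd hv (hval_of_lt q habs)
    · intro hq
      rw [hSdef, Finset.mem_insert, Finset.mem_insert] at hq
      rcases hq with rfl | rfl | hqL
      · refine ⟨(hcrit₁ ε' Λ' hε' hΛ').2 hy₁, ?_⟩
        show Λ' (f _) ∈ Ioo (-c) c
        rw [hΛ', hz₁, hx₁, zero_add, mul_one]
        exact abs_lt.1 hε'c
      · refine ⟨(hcrit₂ ε' Λ' hε' hΛ').2 hy₂, ?_⟩
        show Λ' (f _) ∈ Ioo (-c) c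
        rw [hΛ', hz₂, hx₂, zero_add, mul_neg, mul_one]
        have := abs_lt.1 hε'c
        constructor <;> linarith [this.1, this.2]
      · exact ⟨(isMCriticalPt_and_morseIndex_height_of_mem hf Λ' hΛ' hqL
          (hval_of_lt q (hL' q hqL))).1, abs_lt.1 (hL' q hqL)⟩
  -- the signed count for one sign of `ε`
  have hcount : ∀ (ε' : ℝ) (Λ' : EuclideanSpace ℝ (Fin 3) →L[ℝ] ℝ), ε' ≠ 0 → ε' ^ 2 = ε ^ 2 →
      |ε'| < c → (∀ x, Λ' x = x 2 + ε' * x 0) → (∀ p ∈ L, |Λ' (f p)| < c) →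
      ∑ k ∈ Finset.range 6, (-1 : ℤ) ^ k *
        ((criticalSetOfIndex (𝓡 4)
            ((fun w : Metric.sphere (0 : EuclideanSpace ℝ (Fin 3)) 1 => Λ' w) ∘ f) k ∩
          ((fun w : Metric.sphere (0 : EuclideanSpace ℝ (Fin 3)) 1 => Λ' w) ∘ f) ⁻¹' Ioo (-c) c).ncard
            : ℤ) =
        (-1 : ℤ) ^ ((if 0 < ε' then 1 else 0) + σ₁) +
          (-1 : ℤ) ^ ((if 0 < -ε' then 1 else 0) + σ₂) + (L.card : ℤ) := by
    intro ε' Λ' hε' hε'2 hε'c hΛ' hL'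
    have hval_of_lt : ∀ p ∈ L, (Λ' (f p)) ^ 2 ≠ 1 + ε' ^ 2 := by
      intro p hp heq
      have hp' := hL' p hp
      have h1 : (Λ' (f p)) ^ 2 < c ^ 2 := by
        have := abs_nonneg (Λ' (f p))
        nlinarith [sq_abs (Λ' (f p)), hp']
      rw [heq, hε'2] at h1
      linarith
    have hiL : ∀ q ∈ L, morseIndex (𝓡 4)
        ((fun w : Metric.sphere (0 : EuclideanSpace ℝ (Fin 3)) 1 => Λ' w) ∘ f) q = 2 := fun q hq =>
      (isMCriticalPt_and_morseIndex_height_of_mem hf Λ' hΛ' hq (hval_of_lt q hq)).2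
    have hi₁ := (hidx₁ ε' Λ' hε' hΛ' hy₁).2
    have hi₂ := (hidx₂ ε' Λ' hε' hΛ' hy₂).2
    rw [hx₁, mul_one] at hi₁
    rw [hx₂, mul_neg, mul_one] at hi₂
    rw [morseCount_slab_eq_sum S (hclass ε' Λ' hε' hε'2 hε'c hΛ' hL') (N := 6) ?_]
    · rw [hSdef, Finset.sum_insert hp₁S, Finset.sum_insert (fun h' => hp₂L h'), hi₁, hi₂,
        Finset.sum_congr rfl fun q hq => by rw [hiL q hq]]
      simp
      ring
    · intro q hq
      rw [hSdef, Finset.mem_insert, Finset.mem_insert] at hq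
      rcases hq with rfl | rfl | hqL
      · rw [hi₁]; rcases hσ₁ with h' | h' <;> rw [h'] <;> split_ifs <;> norm_num
      · rw [hi₂]; rcases hσ₂ with h' | h' <;> rw [h'] <;> split_ifs <;> norm_num
      · rw [hiL q hqL]; norm_num
  rw [hcount ε Λ₁ hε rfl hεc hΛ₁ hL₁,
    hcount (-ε) Λ₂ (neg_ne_zero.2 hε) (by ring) (by rwa [abs_neg]) hΛ₂ hL₂, neg_neg]
  -- the indices at the round points flip parity under `ε ↦ -ε`
  rcases lt_or_gt_of_ne hε with hneg | hpos
  · have h1 : ¬ (0 < ε) := not_lt.2 hneg.le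
    have h2 : 0 < -ε := neg_pos.2 hneg
    simp only [h1, h2, if_false, if_true, zero_add]
    ring
  · have h2 : ¬ (0 < -ε) := not_lt.2 (neg_nonpos.2 hpos.le)
    simp only [hpos, h2, if_false, if_true, zero_add]
    ring

end RoundPoint

end Literature.Topology.FourManifolds
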